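import Literature.NumberTheory.DiophantineGeometry.OptimizedSimplifiedHeightBoundsProofs
import Mathlib.Analysis.Complex.ExponentialBounds
import HarnessLib

/-!
# von Känel–Matschke, Theorem G and Corollary H from Theorem 7.2 (i), and the Ramanujan–Nagell bound of
# Corollary K in the shape its printed proof supports (proofs)

Topic `Literature/NumberTheory/DiophantineGeometry` (family `abc`). A proofs-only companion (theorems only;
NO definition, NO new named fact, nothing restated; D-0014, D-0026) of
`MordellThueRamanujanNagellHeightBounds.lean`, which types §1.2 / §7 / §9 of R. von Känel, B. Matschke,
arXiv:1605.06079 = Mem. AMS 286 (2023) no. 1419 [`VonkanelMatschke2023`] as named facts.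

## What is proved here (the printed intra-paper deductions, held TeX text read at the locators)

* `uTwo_intCast_eq_one_of_isPrimitivePair`, `isAlmostPrimitive_intCast_of_isPrimitivePair` — §7, Def. 7.1:
  *"`(x,y) ∈ ℤ × ℤ` is primitive if and only if it is almost primitive with respect to all functions `μ`"*
  (the direction used below: a primitive integral pair has `u₁ = u₂ = 1`, `u = 1`, `h(u) = 0 ≤ μ(a_S)`).
* `theoremG_of_theorem_7_2_i` — §1.2.1: Theorem G is obtained by *"(take `μ = 0` in Theorem (thm:m))"*:
  `(2/3)a_S log a_S + (1/4)a_S log₃a_S + (3/5)a_S ≤ a_S log a_S` for `a_S ≥ 1728`.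
* `corollaryH_of_theorem_7_2_i` — §1.2.1: *"`a_* ≤ 1728 rad(a)²` and Theorem (thm:m) with `μ = 0` directly
  implies"* Corollary H: (1st sentence) the primitive `(x, y)` with `0 ≠ y² − x³ = a`, `rad(a) ≤ n` have
  `max(h(x), (2/3)h(y))` bounded in terms of `n` only, hence lie in a finite box; (2nd sentence) for a primitive
  solution the second display of Thm. 7.2 (i) gives `log|a| ≤ log 2 + 3·((2/9)A log A + (1/12)A log₃A + (1/4)A)
  < A log A` (`A = a_* ≥ 1728`), contradicting `log|a| ≥ a_* log a_*`.
* `corollaryK_log_of_corollary_9_1_sim` — §9, after Cor. 9.1: *"It holds `Ω_opt ≤ Ω_sim` and we observe that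
  `3Ω_sim + 8 log N_S` is at most `2a_S + h(a)`. Therefore … Corollary (cor:ranabounds) proves Corollary K"*.
  FINDING (numerics, recorded here and NOT a kernel refutation of `corollaryK`): with the printed
  `Ω_sim = (1/3)h(a) + (4/9)a_S log a_S + (1/6)a_S log₃a_S + (2/5)a_S` one has
  `3Ω_sim − h(a) ≥ (4/3)a_S log a_S > 9.9 a_S > 2a_S` (`a_S ≥ 1728`), so the quoted observation does not hold
  and the printed chain Cor. 9.1 ⟹ Cor. K yields `2a_S log a_S + h(a) + 3h(c)` (proved below:
  `3Ω_sim + 8 log N_S ≤ 2a_S log a_S + h(a)`, using `N_S² ∣ a_S/1728`), not the displayed `2a_S + h(a) + 3h(c)`.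
  The typed fact `corollaryK` renders the display of the arXiv text verbatim; whether the Memoirs version
  prints `2a_S log a_S` could not be checked (text not held). No counterexample to `corollaryK` is claimed.

No `abc` claim; axioms standard.
-/

noncomputable section

open Height

namespace Literature.NumberTheory.DiophantineGeometry

namespace VonKanelMatschke

/-! ### Real-analysis helper -/

/-- `log log log x ≤ log x − 2` for `x ≥ 16`. [folklore] -/
private theorem logloglog_le_log_sub_two_B {x : ℝ} (hx : 16 ≤ x) :
    Real.log (Real.log (Real.log x)) ≤ Real.log x - 2 := by
  have hl2 := Real.log_two_gt_d9
  have h16 : Real.log 16 = 4 * Real.log 2 := by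
    rw [show (16 : ℝ) = 2 ^ 4 by norm_num, Real.log_pow]; push_cast; ring
  have hlx : 1 < Real.log x := by
    have := Real.log_le_log (by norm_num) hx
    linarith
  have h1 := Real.log_le_sub_one_of_pos (Real.log_pos hlx)
  have h2 : Real.log (Real.log x) ≤ Real.log x - 1 := Real.log_le_sub_one_of_pos (by linarith)
  linarith

/-- `log 1728 ≥ 7.43` (`1728 = 2¹⁰ · 1.6875`, `log 2 > 0.6931`, and `log 1.6875 ≥ 1/2` since
`exp(1/2)² = e < 2.72 < 1.6875²`). [folklore] -/
private theorem log_1728_ge : (7.43 : ℝ) ≤ Real.log 1728 := by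
  have hl2 := Real.log_two_gt_d9
  have he := Real.exp_one_lt_d9
  have h1 : Real.log 1728 = 10 * Real.log 2 + Real.log 1.6875 := by
    rw [show (1728 : ℝ) = 2 ^ 10 * 1.6875 by norm_num, Real.log_mul (by norm_num) (by norm_num),
      Real.log_pow]; push_cast; ring
  have h2 : (1 / 2 : ℝ) ≤ Real.log 1.6875 := by
    rw [Real.le_log_iff_exp_le (by norm_num)]
    have hsq : Real.exp (1 / 2) ^ 2 = Real.exp 1 := by rw [← Real.exp_nat_mul]; norm_num
    have hpos : 0 < Real.exp (1 / 2 : ℝ) := Real.exp_pos _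
    nlinarith
  rw [h1]; linarith

/-! ### Primitive integral pairs are almost primitive for every `μ` (Definition 7.1) -/

/-- For a primitive `(x, y) ∈ ℤ × ℤ` the integer `u₂` of Definition 7.1 is `1`: `u₁ = 1`, and any `n ≥ 2`
with `n⁶ ∣ gcd(x³, y²)` would contradict primitivity. [cite: VonkanelMatschke2023, Def. 7.1 (def:ap) and the remark following it] -/
theorem uTwo_intCast_eq_one_of_isPrimitivePair {x y : ℤ} (h : IsPrimitivePair x y) :
    uTwo (x : ℚ) (y : ℚ) = 1 := by
  have hxy : ¬ (x = 0 ∧ y = 0) := by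
    rintro ⟨rfl, rfl⟩
    have := h 2 (by norm_num) (by norm_num)
    omega
  unfold uTwo
  rw [uOne_intCast]
  simp only [Nat.cast_one, one_pow, one_mul, Rat.num_intCast]
  rw [Nat.findGreatest_eq_iff]
  have hg0 : Int.gcd (x ^ 3) (y ^ 2) ≠ 0 := by
    intro h0
    rw [Int.gcd_eq_zero_iff] at h0
    exact hxy ⟨pow_eq_zero_iff (by norm_num) |>.mp h0.1, pow_eq_zero_iff (by norm_num) |>.mp h0.2⟩
  refine ⟨Nat.one_le_iff_ne_zero.mpr hg0, fun _ => by simp, fun n hn _ hdvd => ?_⟩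
  have hdvd' : ((n : ℤ)) ^ 6 ∣ (Int.gcd (x ^ 3) (y ^ 2) : ℤ) := by exact_mod_cast hdvd
  have h3 : (n : ℤ) ^ 6 ∣ x ^ 3 := hdvd'.trans (Int.gcd_dvd_left _ _)
  have h2 : (n : ℤ) ^ 6 ∣ y ^ 2 := hdvd'.trans (Int.gcd_dvd_right _ _)
  rcases h n h3 h2 with h1 | h1 <;> omega

/-- **A primitive `(x, y) ∈ ℤ × ℤ` is almost primitive with respect to every `μ ≥ 0`** (§7, after Def. 7.1:
"`(x,y) ∈ ℤ × ℤ` is primitive if and only if it is almost primitive with respect to all functions `μ`"; the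
direction `⟹`): `u = u₁/u₂ = 1`, `h(1) = 0 ≤ μ(a_S)`. [cite: VonkanelMatschke2023, Def. 7.1 (def:ap) and the remark following it] -/
theorem isAlmostPrimitive_intCast_of_isPrimitivePair (μ : ℕ → ℝ) (hμ : ∀ n, 0 ≤ μ n) (S : Finset ℕ)
    (a : ℚ) {x y : ℤ} (h : IsPrimitivePair x y) : IsAlmostPrimitive μ S a x y := by
  unfold IsAlmostPrimitive uRatio
  rw [uOne_intCast, uTwo_intCast_eq_one_of_isPrimitivePair h]
  simpa using hμ (mordellLevel S a)

/-! ### Theorem G from Theorem 7.2 (i) with `μ = 0` -/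

/-- The first display of Thm. 7.2 (i) at `μ = 0` is dominated by `a_S log a_S`: for real `A ≥ 1728`,
`(2/3)A log A + (1/4)A log₃A + (3/5)A ≤ A log A` (`log₃A ≤ log A − 2`, `log A ≥ 7.43`).
[cite: VonkanelMatschke2023, §1.2.1 (Theorem G = Thm. 7.2 (i) with μ = 0)] -/
theorem thm_7_2_i_first_le_mul_log {A : ℝ} (hA : 1728 ≤ A) :
    2 / 3 * A * Real.log A + 1 / 4 * A * Real.log (Real.log (Real.log A)) + 3 / 5 * A ≤ A * Real.log A := by
  have hA0 : 0 ≤ A := by linarith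
  have hlogA : 7.43 ≤ Real.log A := log_1728_ge.trans (Real.log_le_log (by norm_num) hA)
  have h3 := logloglog_le_log_sub_two_B (show (16 : ℝ) ≤ A by linarith)
  have t1 : A * Real.log (Real.log (Real.log A)) ≤ A * (Real.log A - 2) := mul_le_mul_of_nonneg_left h3 hA0
  nlinarith

/-- **Theorem G ⇐ Theorem 7.2 (i)** ("take `μ = 0` in Theorem (thm:m)", §1.2.1): a primitive integral
solution is almost primitive with respect to `μ = 0` (`isAlmostPrimitive_intCast_of_isPrimitivePair`), so the
first display of Thm. 7.2 (i) applies to every solution in `𝒪 × 𝒪`, and `thm_7_2_i_first_le_mul_log`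
(`a_S ≥ 1728`). [cite: VonkanelMatschke2023, Theorem G (§1.2.1) with Thm. 7.2 (i)] -/
theorem theoremG_of_theorem_7_2_i (h : theorem_7_2_i) : theoremG := by
  intro S hS a ha hprim x y hx hy hxy
  obtain ⟨x₀, y₀, h₀, hp₀⟩ := hprim
  have ha' : (a : ℚ) ≠ 0 := by exact_mod_cast ha
  have hap : ∃ x₁ y₁ : ℚ, IsSInteger S x₁ ∧ IsSInteger S y₁ ∧ y₁ ^ 2 = x₁ ^ 3 + a ∧
      IsAlmostPrimitive (fun _ => 0) S a x₁ y₁ :=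
    ⟨x₀, y₀, isSInteger_intCast S x₀, isSInteger_intCast S y₀, by exact_mod_cast h₀,
      isAlmostPrimitive_intCast_of_isPrimitivePair _ (fun _ => le_rfl) S a hp₀⟩
  have h1 := (h (fun _ => 0) (fun _ => le_rfl) S hS a ha' (isSInteger_intCast S a) hap x y hx hy hxy).1
  have hA : (1728 : ℝ) ≤ (mordellLevel S a : ℝ) := by exact_mod_cast le_mordellLevel hS a
  have h2 := thm_7_2_i_first_le_mul_log hA
  simp only [mul_zero, add_zero] at h1
  exact h1.trans h2

/-! ### Corollary H from Theorem 7.2 (i) with `μ = 0` -/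

/-- `a_* = a_∅ ≤ 1728 rad(a)²` for a nonzero integer `a` (§1.2.1: "it holds `a_* ≤ 1728 rad(a)²`"):
`∏_{p ∣ a} p^{min(2, ord_p a)} ≤ ∏_{p ∣ a} p² = rad(a)²`. [cite: VonkanelMatschke2023, §1.2.1 (a_* ≤ 1728 rad(a)²)] -/
theorem mordellLevel_empty_le (a : ℤ) :
    mordellLevel ∅ (a : ℚ) ≤ 1728 * UniqueFactorizationMonoid.radical a.natAbs ^ 2 := by
  rw [mordellLevel_def, primesProd_empty, Rat.num_intCast, Finset.sdiff_empty,
    Nat.radical_eq_prod_primeFactors, ← Finset.prod_pow]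
  simp only [one_pow, mul_one]
  refine Nat.mul_le_mul_left _ (Finset.prod_le_prod' fun p hp => ?_)
  exact Nat.pow_le_pow_right (Nat.prime_of_mem_primeFactors hp).pos (min_le_left _ _)

/-- `log|a| ≤ log 2 + 3·max(h(x), (2/3)h(y))` for integers with `y² = x³ + a`, `a ≠ 0`
(`|a| ≤ |y|² + |x|³ ≤ 2 max(H(x)³, H(y)²)`, `H = max(1,|·|)`). [cite: VonkanelMatschke2023, §1.2.1 (proof of Corollary H)] -/
theorem log_abs_le_of_mordell {x y a : ℤ} (ha : a ≠ 0) (hxy : y ^ 2 = x ^ 3 + a) :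
    Real.log |(a : ℝ)| ≤ Real.log 2 + 3 * max (logHeight₁ (x : ℚ)) (2 / 3 * logHeight₁ (y : ℚ)) := by
  have hx : logHeight₁ (x : ℚ) = Real.log (max |(x : ℝ)| 1) := by
    rw [Rat.logHeight₁_eq_log_max]; simp
  have hy : logHeight₁ (y : ℚ) = Real.log (max |(y : ℝ)| 1) := by
    rw [Rat.logHeight₁_eq_log_max]; simp
  set X : ℝ := max |(x : ℝ)| 1 with hX
  set Y : ℝ := max |(y : ℝ)| 1 with hY
  have hX1 : 1 ≤ X := le_max_right _ _
  have hY1 : 1 ≤ Y := le_max_right _ _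
  have hxX : |(x : ℝ)| ≤ X := le_max_left _ _
  have hyY : |(y : ℝ)| ≤ Y := le_max_left _ _
  set M : ℝ := max (Real.log X) (2 / 3 * Real.log Y) with hM
  have hM0 : 0 ≤ M := (Real.log_nonneg hX1).trans (le_max_left _ _)
  -- `|a| ≤ X³ + Y² ≤ 2 exp(3M)`
  have ha_le : |(a : ℝ)| ≤ X ^ 3 + Y ^ 2 := by
    have h1 : (a : ℝ) = (y : ℝ) ^ 2 - (x : ℝ) ^ 3 := by
      have : (a : ℤ) = y ^ 2 - x ^ 3 := by linarith
      exact_mod_cast this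
    rw [h1]
    have h2 : |(x : ℝ)| ^ 3 ≤ X ^ 3 := pow_le_pow_left₀ (abs_nonneg _) hxX 3
    have h3 : |(y : ℝ)| ^ 2 ≤ Y ^ 2 := pow_le_pow_left₀ (abs_nonneg _) hyY 2
    calc |(y : ℝ) ^ 2 - (x : ℝ) ^ 3| ≤ |(y : ℝ) ^ 2| + |(x : ℝ) ^ 3| := abs_sub _ _
      _ = |(y : ℝ)| ^ 2 + |(x : ℝ)| ^ 3 := by rw [abs_pow, abs_pow]
      _ ≤ X ^ 3 + Y ^ 2 := by linarith
  have hX3 : X ^ 3 ≤ Real.exp (3 * M) := by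
    have : Real.log (X ^ 3) ≤ 3 * M := by
      rw [Real.log_pow]; push_cast; nlinarith [le_max_left (Real.log X) (2 / 3 * Real.log Y)]
    calc X ^ 3 = Real.exp (Real.log (X ^ 3)) := (Real.exp_log (by positivity)).symm
      _ ≤ Real.exp (3 * M) := Real.exp_le_exp.mpr this
  have hY2 : Y ^ 2 ≤ Real.exp (3 * M) := by
    have : Real.log (Y ^ 2) ≤ 3 * M := by
      rw [Real.log_pow]; push_cast; nlinarith [le_max_right (Real.log X) (2 / 3 * Real.log Y)]
    calc Y ^ 2 = Real.exp (Real.log (Y ^ 2)) := (Real.exp_log (by positivity)).symm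
      _ ≤ Real.exp (3 * M) := Real.exp_le_exp.mpr this
  have ha0 : 0 < |(a : ℝ)| := abs_pos.mpr (by exact_mod_cast ha)
  have h4 : |(a : ℝ)| ≤ 2 * Real.exp (3 * M) := by linarith
  have h5 : Real.log |(a : ℝ)| ≤ Real.log (2 * Real.exp (3 * M)) := Real.log_le_log ha0 h4
  rw [Real.log_mul (by norm_num) (Real.exp_pos _).ne', Real.log_exp] at h5
  rw [hx, hy]
  linarith

/-- **Corollary H ⇐ Theorem 7.2 (i)** (§1.2.1: "`a_* ≤ 1728 rad(a)²` and Theorem (thm:m) with `μ = 0` directly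
implies the following corollary"). First sentence: for primitive `(x, y)` with `0 ≠ a = y² − x³`, `rad(a) ≤ n`, the
second display of Thm. 7.2 (i) (`S = ∅`, `μ = 0`, the solution itself being almost primitive) bounds
`max(h(x), (2/3)h(y))` by `(2/9)A log A + (1/12)A log₃A + (1/4)A ≤ B(n)` with `A = a_* ≤ 1728 n²`, so `|x|, |y|`
lie in a finite box. Second sentence: the same display and `log|a| ≤ log 2 + 3 max(h(x), (2/3)h(y))` give
`log|a| < a_* log a_*`. ("can in principle be determined" is not part of the typed statement.)
[cite: VonkanelMatschke2023, Corollary H (§1.2.1) with Thm. 7.2 (i)] -/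
theorem corollaryH_of_theorem_7_2_i (h : theorem_7_2_i) : corollaryH := by
  have hS : ∀ p ∈ (∅ : Finset ℕ), p.Prime := by simp
  -- the second display of Thm. 7.2 (i) for a primitive integral solution, `S = ∅`, `μ = 0`
  have key : ∀ (a x y : ℤ), a ≠ 0 → IsPrimitivePair x y → y ^ 2 = x ^ 3 + a →
      max (logHeight₁ (x : ℚ)) (2 / 3 * logHeight₁ (y : ℚ)) ≤
        2 / 9 * (mordellLevel ∅ a : ℝ) * Real.log (mordellLevel ∅ a) +
          1 / 12 * (mordellLevel ∅ a : ℝ) * Real.log (Real.log (Real.log (mordellLevel ∅ a))) +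
          1 / 4 * (mordellLevel ∅ a : ℝ) := by
    intro a x y ha hp hxy
    have ha' : (a : ℚ) ≠ 0 := by exact_mod_cast ha
    have hap := isAlmostPrimitive_intCast_of_isPrimitivePair (fun _ => (0 : ℝ)) (fun _ => le_rfl) ∅ (a : ℚ) hp
    have hsol : ((y : ℤ) : ℚ) ^ 2 = ((x : ℤ) : ℚ) ^ 3 + (a : ℚ) := by exact_mod_cast hxy
    have h1 := (h (fun _ => 0) (fun _ => le_rfl) ∅ hS a ha' (isSInteger_intCast ∅ a)
      ⟨x, y, isSInteger_intCast ∅ x, isSInteger_intCast ∅ y, hsol, hap⟩ x y (isSInteger_intCast ∅ x)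
      (isSInteger_intCast ∅ y) hsol).2 hap
    simpa using h1
  refine ⟨fun n hn => ?_, fun a ha hlog x y hp hxy => ?_⟩
  · -- finiteness: a uniform height bound `B` in terms of `n`
    set An : ℝ := 1728 * (n : ℝ) ^ 2 with hAn
    set B : ℝ := 2 / 9 * An * Real.log An + 1 / 12 * An * Real.log An + 1 / 4 * An with hB
    have hAn1 : (1728 : ℝ) ≤ An := by
      have : (1 : ℝ) ≤ (n : ℝ) ^ 2 := by exact_mod_cast Nat.one_le_pow 2 n hn
      rw [hAn]; nlinarith
    have hbox : ∀ xy : ℤ × ℤ, xy ∈ {xy : ℤ × ℤ | IsPrimitivePair xy.1 xy.2 ∧ xy.2 ^ 2 - xy.1 ^ 3 ≠ 0 ∧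
        UniqueFactorizationMonoid.radical (xy.2 ^ 2 - xy.1 ^ 3).natAbs ≤ n} →
        xy ∈ (Finset.Icc (-⌈Real.exp B⌉) ⌈Real.exp B⌉) ×ˢ
          (Finset.Icc (-⌈Real.exp (3 / 2 * B)⌉) ⌈Real.exp (3 / 2 * B)⌉) := by
      rintro ⟨x, y⟩ ⟨hp, ha, hrad⟩
      set a : ℤ := y ^ 2 - x ^ 3 with ha_def
      have hxy : y ^ 2 = x ^ 3 + a := by rw [ha_def]; ring
      have h1 := key a x y ha hp hxy
      -- `A = a_* ≤ 1728 n²`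
      have hA : (mordellLevel ∅ (a : ℚ) : ℝ) ≤ An := by
        have h2 := mordellLevel_empty_le a
        have h3 : UniqueFactorizationMonoid.radical a.natAbs ^ 2 ≤ n ^ 2 := Nat.pow_le_pow_left hrad 2
        have h4 : mordellLevel ∅ (a : ℚ) ≤ 1728 * n ^ 2 := h2.trans (Nat.mul_le_mul_left _ h3)
        rw [hAn]; exact_mod_cast h4
      have hA0 : (1728 : ℝ) ≤ (mordellLevel ∅ (a : ℚ) : ℝ) := by exact_mod_cast le_mordellLevel hS (a : ℚ)
      set A : ℝ := (mordellLevel ∅ (a : ℚ) : ℝ) with hAdef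
      have hlogA : Real.log A ≤ Real.log An := Real.log_le_log (by linarith) hA
      have hlogA0 : 0 ≤ Real.log A := Real.log_nonneg (by linarith)
      have hl3 : Real.log (Real.log (Real.log A)) ≤ Real.log An := by
        have := logloglog_le_log_sub_two_B (show (16 : ℝ) ≤ A by linarith); linarith
      have hM : max (logHeight₁ (x : ℚ)) (2 / 3 * logHeight₁ (y : ℚ)) ≤ B := by
        have t1 : A * Real.log A ≤ An * Real.log An := mul_le_mul hA hlogA hlogA0 (by linarith)
        have t2 : A * Real.log (Real.log (Real.log A)) ≤ An * Real.log An := by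
          calc A * Real.log (Real.log (Real.log A)) ≤ A * Real.log An :=
                mul_le_mul_of_nonneg_left hl3 (by linarith)
            _ ≤ An * Real.log An := mul_le_mul_of_nonneg_right hA (hlogA0.trans hlogA)
        rw [hB]; linarith
      have hxB : logHeight₁ (x : ℚ) ≤ B := (le_max_left _ _).trans hM
      have hyB : logHeight₁ (y : ℚ) ≤ 3 / 2 * B := by
        have := (le_max_right _ _).trans hM; linarith
      have habs : ∀ (z : ℤ) (C : ℝ), logHeight₁ (z : ℚ) ≤ C → z ∈ Finset.Icc (-⌈Real.exp C⌉) ⌈Real.exp C⌉ := by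
        intro z C hz
        have h1 : Real.log (max |(z : ℝ)| 1) ≤ C := by
          rw [Rat.logHeight₁_eq_log_max] at hz; simpa using hz
        have h2 : max |(z : ℝ)| 1 ≤ Real.exp C := by
          rw [← Real.exp_log (show 0 < max |(z : ℝ)| 1 by positivity)]; exact Real.exp_le_exp.mpr h1
        have h3 : |(z : ℝ)| ≤ ⌈Real.exp C⌉ := ((le_max_left _ _).trans h2).trans (Int.le_ceil _)
        have h4 : |z| ≤ ⌈Real.exp C⌉ := by exact_mod_cast h3
        rw [Finset.mem_Icc]; constructor <;> linarith [abs_le.mp h4]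
      exact Finset.mem_product.mpr ⟨habs x B hxB, habs y (3 / 2 * B) hyB⟩
    exact Set.Finite.subset (Finset.finite_toSet _) fun xy hxy => hbox xy hxy
  · -- no primitive solution when `log|a| ≥ a_* log a_*`
    have h1 := key a x y ha hp hxy
    have h2 := log_abs_le_of_mordell ha hxy
    have hA0 : (1728 : ℝ) ≤ (mordellLevel ∅ (a : ℚ) : ℝ) := by exact_mod_cast le_mordellLevel hS (a : ℚ)
    set A : ℝ := (mordellLevel ∅ (a : ℚ) : ℝ) with hAdef
    have hlogA : 7.43 ≤ Real.log A := log_1728_ge.trans (Real.log_le_log (by norm_num) hA0)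
    have hl3 := logloglog_le_log_sub_two_B (show (16 : ℝ) ≤ A by linarith)
    have hl2 := Real.log_two_lt_d9
    have t1 : A * Real.log (Real.log (Real.log A)) ≤ A * (Real.log A - 2) :=
      mul_le_mul_of_nonneg_left hl3 (by linarith)
    -- `log|a| ≤ log 2 + (2/3)A log A + (1/4)A log₃A + (3/4)A < A log A ≤ log|a|`
    have hlt : Real.log 2 + 3 * (2 / 9 * A * Real.log A + 1 / 12 * A * Real.log (Real.log (Real.log A)) +
        1 / 4 * A) < A * Real.log A := by nlinarith
    linarith

/-! ### Corollary K in the shape its printed proof supports: `2a_S log a_S + h(a) + 3h(c)` -/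

/-- `3Ω_sim(a, S) + 8 log N_S ≤ 2a_S log a_S + h(a)` (`a ≠ 0` in `𝒪`; `N_S² ∣ a_S/1728`, so
`8 log N_S ≤ 4 log a_S`; `log₃a_S ≤ log a_S − 2`; `log a_S ≤ a_S/1000 + 6`; `a_S ≥ 1728`) — the inequality
which the printed sentence after Cor. 9.1 needs, with `2a_S log a_S` in place of the printed `2a_S` (see the
module docstring FINDING: `3Ω_sim − h(a) ≥ (4/3)a_S log a_S > 2a_S`).
[cite: VonkanelMatschke2023, §9 (sentence after the proof of Cor. 9.1)] -/
theorem three_mul_omegaSim_add_le {S : Finset ℕ} (hS : ∀ p ∈ S, p.Prime) (a : ℚ) :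
    3 * omegaSim S a + 8 * Real.log (primesProd S) ≤
      2 * (mordellLevel S a : ℝ) * Real.log (mordellLevel S a) + logHeight₁ a := by
  have hA0 : (1728 : ℝ) ≤ (mordellLevel S a : ℝ) := by exact_mod_cast le_mordellLevel hS a
  have hN1 : (1 : ℝ) ≤ (primesProd S : ℝ) := by exact_mod_cast one_le_primesProd hS
  -- `1728 N_S² ≤ a_S`
  have hNA : 1728 * (primesProd S : ℝ) ^ 2 ≤ (mordellLevel S a : ℝ) := by
    have h1 : 1 ≤ coprimePartTrunc S a := by
      rw [coprimePartTrunc]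
      exact Nat.one_le_iff_ne_zero.mpr (Finset.prod_ne_zero_iff.mpr fun p hp =>
        pow_ne_zero _ (Nat.prime_of_mem_primeFactors (Finset.mem_sdiff.mp hp).1).ne_zero)
    have h2 : 1728 * primesProd S ^ 2 * 1 ≤ mordellLevel S a := Nat.mul_le_mul_left _ h1
    exact_mod_cast (by simpa using h2)
  set A : ℝ := (mordellLevel S a : ℝ) with hAdef
  set N : ℝ := (primesProd S : ℝ) with hNdef
  have hlogN : 2 * Real.log N ≤ Real.log A := by
    have h1 : Real.log (N ^ 2) ≤ Real.log A :=
      Real.log_le_log (by positivity) (by nlinarith)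
    rwa [Real.log_pow, Nat.cast_ofNat] at h1
  have hlogA : 7.43 ≤ Real.log A := log_1728_ge.trans (Real.log_le_log (by norm_num) hA0)
  have hl3 := logloglog_le_log_sub_two_B (show (16 : ℝ) ≤ A by linarith)
  have hlogA' : Real.log A ≤ A / 1000 + 6 := by
    have h1 : Real.log (A / 1000) ≤ A / 1000 - 1 := Real.log_le_sub_one_of_pos (by positivity)
    have h2 : Real.log (A / 1000) = Real.log A - Real.log 1000 := Real.log_div (by linarith) (by norm_num)
    have h3 : Real.log 1000 ≤ 7 := by
      have hl2 := Real.log_two_lt_d9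
      have h4 : Real.log 1000 ≤ Real.log 1024 := Real.log_le_log (by norm_num) (by norm_num)
      rw [show (1024 : ℝ) = 2 ^ 10 by norm_num, Real.log_pow] at h4
      push_cast at h4; linarith
    linarith
  have hh : 0 ≤ logHeight₁ a := zero_le_logHeight₁ a
  have t1 : A * Real.log (Real.log (Real.log A)) ≤ A * (Real.log A - 2) := mul_le_mul_of_nonneg_left hl3 (by linarith)
  rw [omegaSim]
  nlinarith

/-- **Corollary K with `2a_S log a_S`** — the bound which the printed chain "Cor. 9.1, `Ω_opt ≤ Ω_sim`,
`3Ω_sim + 8 log N_S ≤ …`" (§9) actually delivers — PROVED from the simplified Cor. 9.1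
(`corollary_9_1_sim`, vKM Cor. 9.1 with the THEOREM `Ω_opt ≤ Ω_sim`): *if `(x, y) ∈ 𝒪 × 𝒪^×` satisfies
`x² + b = cy` (`b, c ∈ 𝒪` nonzero, `a = bc²`), then `max(2h(x), h(y)) ≤ 2a_S log a_S + h(a) + 3h(c)`.* The
displayed Cor. K of the arXiv text has `2a_S` (typed verbatim as `corollaryK`; see the FINDING in the module
docstring). [cite: VonkanelMatschke2023, Corollary K (§1.2.3) and §9 (its derivation from Cor. 9.1)] -/
theorem corollaryK_log_of_corollary_9_1_sim (h : corollary_9_1_sim) :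
    ∀ (S : Finset ℕ), (∀ p ∈ S, p.Prime) → ∀ b c : ℚ, b ≠ 0 → c ≠ 0 → IsSInteger S b → IsSInteger S c →
      ∀ x y : ℚ, IsSInteger S x → IsSUnit S y → x ^ 2 + b = c * y →
        max (2 * logHeight₁ x) (logHeight₁ y) ≤
          2 * (mordellLevel S (b * c ^ 2) : ℝ) * Real.log (mordellLevel S (b * c ^ 2)) +
            logHeight₁ (b * c ^ 2) + 3 * logHeight₁ c := by
  intro S hS b c hb hc hbS hcS x y hx hy hxy
  have h1 := h S hS b c hb hc hbS hcS x y hx hy hxy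
  have h2 := three_mul_omegaSim_add_le hS (b * c ^ 2)
  rw [logHeight₁_pow] at h1
  push_cast at h1
  exact h1.trans (by linarith)

/-- **Corollary K with `2a_S log a_S` from the exact Cor. 9.1** (`corollary_9_1`, through `corollary_9_1_sim_of'`).
[cite: VonkanelMatschke2023, Corollary K (§1.2.3) and Cor. 9.1 (§9)] -/
theorem corollaryK_log_of_corollary_9_1 (h : corollary_9_1) :
    ∀ (S : Finset ℕ), (∀ p ∈ S, p.Prime) → ∀ b c : ℚ, b ≠ 0 → c ≠ 0 → IsSInteger S b → IsSInteger S c →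
      ∀ x y : ℚ, IsSInteger S x → IsSUnit S y → x ^ 2 + b = c * y →
        max (2 * logHeight₁ x) (logHeight₁ y) ≤
          2 * (mordellLevel S (b * c ^ 2) : ℝ) * Real.log (mordellLevel S (b * c ^ 2)) +
            logHeight₁ (b * c ^ 2) + 3 * logHeight₁ c :=
  corollaryK_log_of_corollary_9_1_sim (corollary_9_1_sim_of' h)

end VonKanelMatschke

end Literature.NumberTheory.DiophantineGeometry

end
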